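import Summits.ResolutionOfSingularities.ResolutionOfSingularities.Theorems.PurelyInseparableDim4IsolatedBand
import Summits.ResolutionOfSingularities.ResolutionOfSingularities.Theorems.PurelyInseparableDim4SpineDictionary
import Literature.AlgebraicGeometry.Resolution.CentreBlowupMohStability
import HarnessLib

/-!
# [OURS · res-dim4-pi F4-I Lemma (B)] Isolated `q`-fold points carry small exceptional multiplicities;
  at `(p, q) = (2, 2)` the primary letters are frozen on the isolated regime

Cell `res-dim4-pi` (D-0157 DOOR 2), frame v4 TIER 1 (I) (`NoIsolatedTrap`), desk `boards/ROUTES.md` WORD #27 (b)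
«Lemma (B) `isIsolated_imp_r_le`» (seat `res-dim4-p-5`, claimed on the bus 2026-08-28T16:5xZ). Def-free sequel of
`PurelyInseparableDim4IsolatedBand` (IB-1, p649049): the band theorem's core is isolated once more as a statement
about the state ITSELF (`not_isIsolated_of_layer`), and read on the exceptional monomial `x^r ∣ F` of the walk.

## What is proved (every field, every `q ≥ 2` unless stated)
* §1 `not_isIsolated_of_layer`: if every monomial of `F` has `x_i`-exponent `≥ q − 1` (i.e. `F ∈ (x_i)^{q−1}`),
  the origin is NOT an isolated `q`-fold point; `exists_apply_le_of_isIsolated` (contrapositive).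
* §2 **Lemma (B)** `apply_le_of_isIsolated`: `IsIsolated q F ∧ x^r ∣ F ⇒ r_i ≤ q − 2` for every `i`;
  at `q = 2`: `r_eq_zero_of_isIsolated_two` (`r = 0`), `shade_eq_ordZero_of_isIsolated_two` (`d = ord₀ F`).
* §3 `ne_zero_of_edge`, `forall_le_step_of_step0`: along a `Step0` edge `F ≠ 0` and the walk invariant `x^r ∣ F`
  persists (tree `CentreBlowup.newMult_le_of_mem_support_step` at `S = univ`).
* §4 **`isolated_chain_r_eq_zero` / `isolated_chain_shade_eq_two`**: along every `Step0`-chain of ISOLATED states at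
  `q = 2` starting from a state with `x^r ∣ F`, `r_k = 0` and `shade_k = ord₀ F_k = 2` for EVERY `k` — on regime (I)
  at `(2, 2)` there is no RISE:d and no DROP: the primary vector `(ord, d)` is constant (desk WORD #27 (b)), so a
  termination letter there must read finer data (`ē`, `μ₂`, …).

[OURS · counted 0 · AI work weaker than expert review] Nothing here proves `NoIsolatedTrap` or resolution of
singularities in dimension ≥ 4 / characteristic `p`; bookkeeping about OUR candidate frame.
bears_on: LADDER-RESOLUTION:D157-DOOR2 (res-dim4-pi · F4-I Lemma (B)). Supports stmt-ResolutionOfSingularities-16155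
(helper).
-/

set_option linter.dupNamespace false -- mandated namespace of this single-conjunct summit

noncomputable section

namespace Summit.ResolutionOfSingularities.ResolutionOfSingularities.Theorems.PIDim4

namespace IsolatedBand

open MvPolynomial Finset
open Literature.AlgebraicGeometry.Resolution
open Literature.AlgebraicGeometry.Resolution.CentreBlowup
open Literature.AlgebraicGeometry.Resolution.Hauser2010

variable {K : Type} [Field K]

/-! ## §1 `F ∈ (x_i)^{q−1}` is never isolated -/

/-- **The layer criterion for the state itself.** If every monomial of `F` has `x_i`-exponent `≥ q − 1`
(`q ≥ 2`), then the origin is not an isolated `q`-fold point of `z^q + F`: by the layer lemma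
`J_q⁺(F) ≤ (x_i, D^{((q−1)·e_i)} F)`, and either that Hasse derivative does not vanish at `0` (then
`J_q⁺(F) ≰ 𝔪₀`) or two generators in `𝔪₀` cannot isolate the origin (Krull). [folklore] -/
theorem not_isIsolated_of_layer {q : ℕ} (hq : 2 ≤ q) {i : Fin 4} {F : MvPolynomial (Fin 4) K}
    (hF : ∀ e ∈ F.support, q - 1 ≤ e i) : ¬ IsIsolated q F := by
  classical
  have hJ := singLocusIdeal_le_span_pair_of_layer hF
  by_cases hD : hasseDeriv (Finsupp.single i (q - 1)) F ∈ originIdeal K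
  · exact not_isIsolated_of_le_span_pair hJ (IsolatedScope.X_mem_originIdeal i) hD
  · rintro ⟨hle, -⟩
    apply hD
    refine hle (Ideal.subset_span ⟨Finsupp.single i (q - 1), ?_, ?_, rfl⟩)
    · rw [Finsupp.degree_single]; omega
    · rw [Finsupp.degree_single]; omega

/-- Contrapositive: at an isolated `q`-fold point, for every variable `x_i` some monomial of `F` has
`x_i`-exponent `≤ q − 2` (`F ∉ (x_i)^{q−1}`). [folklore] -/
theorem exists_apply_le_of_isIsolated {q : ℕ} (hq : 2 ≤ q) {F : MvPolynomial (Fin 4) K}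
    (hiso : IsIsolated q F) (i : Fin 4) : ∃ e ∈ F.support, e i ≤ q - 2 := by
  by_contra hcon
  push Not at hcon
  exact not_isIsolated_of_layer hq (i := i) (fun e he => by have := hcon e he; omega) hiso

/-! ## §2 Lemma (B): isolated ⇒ small exceptional multiplicities -/

/-- **Lemma (B) (desk WORD #27 (b)).** At an isolated `q`-fold point the exceptional monomial `x^r` dividing
`F` has every exponent `r_i ≤ q − 2`. [folklore] -/
theorem apply_le_of_isIsolated {q : ℕ} (hq : 2 ≤ q) {s : State K} (hiso : IsIsolated q s.F)
    (hr : ∀ d ∈ s.F.support, s.r ≤ d) (i : Fin 4) : s.r i ≤ q - 2 := by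
  obtain ⟨e, he, hei⟩ := exists_apply_le_of_isIsolated hq hiso i
  exact le_trans (Finsupp.le_def.mp (hr e he) i) hei

/-- **`(2,2)`: isolated ⇒ `r = 0`** (no exceptional component through an isolated double point divides
`F`). [folklore] -/
theorem r_eq_zero_of_isIsolated_two {s : State K} (hiso : IsIsolated 2 s.F)
    (hr : ∀ d ∈ s.F.support, s.r ≤ d) : s.r = 0 := by
  ext i
  have := apply_le_of_isIsolated (le_refl 2) hiso hr i
  simpa using this

/-- `(2,2)`: at an isolated double point the shade is the order, `d = ord₀ F`. [folklore] -/
theorem shade_eq_ordZero_of_isIsolated_two {s : State K} (hiso : IsIsolated 2 s.F)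
    (hr : ∀ d ∈ s.F.support, s.r ≤ d) : s.shade = ordZero s.F := by
  unfold CState.shade
  rw [r_eq_zero_of_isIsolated_two hiso hr, map_zero, Nat.cast_zero, tsub_zero]

/-! ## §3 The walk invariant `x^r ∣ F` along `Step0` edges -/

/-- Along an edge the parent polynomial is non-zero (the step of `0` is `0`). [folklore] -/
theorem ne_zero_of_edge [DecidableEq K] {q : ℕ} {S : Finset (Fin 4)} {s s' : State K}
    (h : Edge q S s s') : s.F ≠ 0 := by
  obtain ⟨j, b, -, -, -, hne, -⟩ := h
  exact fun h0 => hne (SpineDictionary.step_F_eq_zero s h0)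

/-- **`x^r ∣ F` persists along `Step0` edges** (point blow-ups): the tree's
`CentreBlowup.newMult_le_of_mem_support_step` at `S = univ`, where Moh-permissibility is automatic.
[folklore] -/
theorem forall_le_step_of_step0 [DecidableEq K] {q : ℕ} {s s' : State K} (h : Step0 q s s')
    (hr : ∀ d ∈ s.F.support, s.r ≤ d) : ∀ d ∈ s'.F.support, s'.r ≤ d := by
  classical
  obtain ⟨-, hedge⟩ := h
  have hF : s.F ≠ 0 := ne_zero_of_edge hedge
  obtain ⟨j, b, -, hbj, -, -, rfl⟩ := hedge
  have hne : ordZero s.F ≠ ⊤ := by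
    unfold ordZero
    rw [Ne, MvPowerSeries.order_eq_top_iff, MvPolynomial.coe_eq_zero_iff]
    exact hF
  obtain ⟨o, ho'⟩ := WithTop.ne_top_iff_exists.mp hne
  have ho : ordZero s.F = o := ho'.symm
  refine newMult_le_of_mem_support_step q Finset.univ j b hbj s ho hr fun d hd => ?_
  -- Moh-permissibility of the point: `|r| + (o − |r|) = o ≤ |d|`
  rw [degIn_univ, degIn_univ]
  have hod : o ≤ d.degree := by
    have := Literature.Barriers.ResolutionOfSingularities.ordZero_le_of_coeff_ne_zero _ _
      (MvPolynomial.mem_support_iff.mp hd)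
    rw [ho] at this
    exact_mod_cast this
  have hrd : s.r.degree ≤ d.degree := PointBlowup.degree_le_degree_of_le (hr d hd)
  omega

/-! ## §4 `(2,2)`: the primary letters are frozen on isolated chains -/

/-- Along a `Step0`-chain of isolated double points starting with `x^r ∣ F₀`, the invariant `x^r ∣ F` holds
throughout. [folklore] -/
theorem isolated_chain_forall_le [DecidableEq K] {q : ℕ} {c : ℕ → State K}
    (hc : ∀ k, IsIsolated q (c k).F ∧ Step0 q (c k) (c (k + 1)))
    (hr : ∀ d ∈ (c 0).F.support, (c 0).r ≤ d) (k : ℕ) : ∀ d ∈ (c k).F.support, (c k).r ≤ d := by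
  induction k with
  | zero => exact hr
  | succ k ih => exact forall_le_step_of_step0 (hc k).2 ih

/-- **`(2,2)`: `r_k = 0` along every isolated `Step0`-chain** (with `x^r ∣ F₀`). [folklore] -/
theorem isolated_chain_r_eq_zero [DecidableEq K] {c : ℕ → State K}
    (hc : ∀ k, IsIsolated 2 (c k).F ∧ Step0 2 (c k) (c (k + 1)))
    (hr : ∀ d ∈ (c 0).F.support, (c 0).r ≤ d) (k : ℕ) : (c k).r = 0 :=
  r_eq_zero_of_isIsolated_two (hc k).1 (isolated_chain_forall_le hc hr k)

/-- **`(2,2)`: THE PRIMARY LETTERS ARE FROZEN ON THE ISOLATED REGIME.** Along every `Step0`-chain of isolated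
double points (with `x^r ∣ F₀`) the shade equals `2` at every state — with IB-1's `isolated_chain_ordZero_eq_two`
(`ord₀ F_k = 2`) the primary vector `(ord, d) = (2, 2)` is constant: no RISE:d, no DROP (desk WORD #27 (b)).
[folklore] -/
theorem isolated_chain_shade_eq_two [DecidableEq K] {c : ℕ → State K}
    (hc : ∀ k, IsIsolated 2 (c k).F ∧ Step0 2 (c k) (c (k + 1)))
    (hr : ∀ d ∈ (c 0).F.support, (c 0).r ≤ d) (k : ℕ) : (c k).shade = 2 := by
  rw [shade_eq_ordZero_of_isIsolated_two (hc k).1 (isolated_chain_forall_le hc hr k)]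
  exact isolated_chain_ordZero_eq_two hc k

/-- Hence on such a chain no edge is a RISE:d or a DROP of the frame. [folklore] -/
theorem isolated_chain_not_riseD_not_dropD [DecidableEq K] {c : ℕ → State K}
    (hc : ∀ k, IsIsolated 2 (c k).F ∧ Step0 2 (c k) (c (k + 1)))
    (hr : ∀ d ∈ (c 0).F.support, (c 0).r ≤ d) (k : ℕ) :
    ¬ RiseD (c k) (c (k + 1)) ∧ ¬ DropD (c k) (c (k + 1)) := by
  unfold RiseD DropD
  rw [isolated_chain_shade_eq_two hc hr k, isolated_chain_shade_eq_two hc hr (k + 1)]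
  exact ⟨lt_irrefl _, lt_irrefl _⟩

end IsolatedBand

end Summit.ResolutionOfSingularities.ResolutionOfSingularities.Theorems.PIDim4

end
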